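import Literature.NumberTheory.GelbartRogawski1991.LocalDoubledUnitaryIwahori
import Literature.RepresentationTheory.HeisenbergGroup.ImplementerOmega
import HarnessLib

-- buildfix G11b-3 recipe (LEDGER B13-1/B13-3): elaborate sequentially so the trailing `attribute [implicit_reducible]`
-- block (reducibilityCoreExt is keyed to the async environment branch) is in force at `.olean` export.
set_option Elab.async false

/-!
# Smoothness of the local Weil representation `ω = β⁻¹ · r ∘ ι` of the doubled unitary group at a non-split place

[cite: MoeglinVignerasWaldspurger1987, Chap. 2 II.8; Kudla1994, Thm 3.1; GelbartRogawski1991, §3.1 Prop. 3.1.1]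

For `H(F_v) = U(T₀ ⊕ −T₀)(E ⊗ F_v)` at a place `v` of `F` not split in `E`, a normalised section of implementers
`r` of the local Schrödinger model, and a splitting function `β` of the multiplier of `r ∘ ι` with the Kudla values
`β(p) = χ_v(det_Δ p)` on the Siegel parabolic `P_Δ`: IF `r ∘ ι` is smooth along `P_Δ` (every `Φ` is fixed by
`r(ι p)` for `p ∈ P_Δ` congruent to `1` at a deep enough level at `w` — the input `stub_L6a` of the GR-1 skeleton)
and `χ_w` is trivial near `1`, THEN the genuine representation `ω(k) = β(k)⁻¹ r(ι k)` of `H(F_v)` is SMOOTH: every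
`Φ` is fixed on an open subgroup (`smooth_of_parabolicSmooth`).

Proof: `Stab_ω(Φ)` is a subgroup (`ImplementerOmega`); it contains the neighbourhood `{k : R⁻¹ k_w R ∈ K_γ}` of `1`
by the Iwahori factorisation `k = p · (w_Δ u w_Δ⁻¹)` inside `H` (`LocalDoubledUnitaryIwahori.exists_factorisation`),
since `ω(p) = χ_v(det_Δ p)⁻¹ r(ι p)` fixes `Φ` and `ω(u)` fixes `ω(w_Δ)⁻¹ Φ` once `γ` is small (the level is
transported through the fixed conjugations `R`, `R s` by `exists_congruenceGL_subset`). No value of the cocycle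
is used.
-/

set_option autoImplicit false

noncomputable section

open NumberField IsDedekindDomain Matrix Filter
open _root_.Topology
open Literature.NumberTheory.Automorphic Literature.NumberTheory.Automorphic.UnitaryGroup
open Literature.NumberTheory.GelbartRogawski1991.AdaptedBlocks
open Literature.RepresentationTheory.HeisenbergGroup

namespace Literature.NumberTheory.GelbartRogawski1991.UnitaryDualPair.LocalSplitting

variable (F : Type) [Field F] [NumberField F] (E : Type) [Field E] [NumberField E] [Algebra F E]
  [Algebra.IsQuadraticExtension F E] (c : E ≃ₐ[F] E)
  {δ : E} (hcδ : c δ = -δ) (hδ : δ ≠ 0) {d : F} (hd : δ * δ = algebraMap F E d)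
  (v : HeightOneSpectrum (𝓞 F)) (n : ℕ) {T₀ : Matrix (Fin n) (Fin n) F} (hT₀ : T₀.IsSymm) (hT₀d : IsUnit T₀.det)
  {JD : Matrix (Fin (n + n)) (Fin (n + n)) E} (hJD : JD = (gramD F n T₀).map (algebraMap F E))

/-! ## §1 Transporting congruence levels through a fixed conjugation; a level below `1` -/

omit [NumberField F] [Algebra.IsQuadraticExtension F E] in
/-- for a fixed `g₀ ∈ GL_N(E_w)` and a neighbourhood `T` of `1`, `g₀ K_γ g₀⁻¹ ⊆ T` for `γ` small.
[cite: MoeglinVignerasWaldspurger1987, Chap. 2 II.8] -/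
theorem exists_congruenceGL_conj_subset (w : PlacesOver E v) {N : ℕ} (g₀ : GL (Fin N) (w.1.adicCompletion E))
    {T : Set (GL (Fin N) (w.1.adicCompletion E))} (hT : T ∈ 𝓝 1) :
    ∃ γ : (ValuativeRel.ValueGroupWithZero (w.1.adicCompletion E))ˣ,
      ∀ x ∈ congruenceGL N (γ : ValuativeRel.ValueGroupWithZero (w.1.adicCompletion E)), g₀ * x * g₀⁻¹ ∈ T := by
  have hcont : Continuous fun x : GL (Fin N) (w.1.adicCompletion E) => g₀ * x * g₀⁻¹ :=
    (continuous_const.mul continuous_id).mul continuous_const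
  have hpre : (fun x : GL (Fin N) (w.1.adicCompletion E) => g₀ * x * g₀⁻¹) ⁻¹' T ∈ 𝓝 1 :=
    hcont.continuousAt.preimage_mem_nhds (by rwa [mul_one, mul_inv_cancel])
  obtain ⟨γ, hγ⟩ := exists_congruenceGL_subset hpre
  exact ⟨γ, fun x hx => hγ hx⟩

omit [NumberField F] [Algebra.IsQuadraticExtension F E] in
/-- there is a level `γ < 1` (the value group of `E_w` is non-trivial). [cite: MoeglinVignerasWaldspurger1987, Chap. 2 II.8] -/
theorem exists_unit_lt_one (w : PlacesOver E v) :
    ∃ γ : (ValuativeRel.ValueGroupWithZero (w.1.adicCompletion E))ˣ,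
      (γ : ValuativeRel.ValueGroupWithZero (w.1.adicCompletion E)) < 1 := by
  obtain ⟨γ, h0, h1⟩ := ValuativeRel.IsNontrivial.condition (R := w.1.adicCompletion E)
  rcases lt_or_gt_of_ne h1 with h | h
  · exact ⟨Units.mk0 γ h0, h⟩
  · refine ⟨(Units.mk0 γ h0)⁻¹, ?_⟩
    rw [Units.val_inv_eq_inv_val, Units.val_mk0]
    exact inv_lt_one_of_one_lt₀ h

/-! ## §2 `χ_v(det_Δ q) = 1` for `q_w` near `1` -/

omit [NumberField F] [Algebra.IsQuadraticExtension F E] in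
/-- `det_Δ` as a function of the `w`-component. [cite: Kudla1994, §3; HarrisKudlaSweet1996, §1 (1.15)] -/
def detDeltaGL (w : PlacesOver E v) (g : GL (Fin (n + n)) (w.1.adicCompletion E)) : w.1.adicCompletion E :=
  ((Matrix.reindex (e₂ n).symm (e₂ n).symm (g : Matrix (Fin (n + n)) (Fin (n + n)) (w.1.adicCompletion E))).toBlocks₁₁ +
    (Matrix.reindex (e₂ n).symm (e₂ n).symm (g : Matrix (Fin (n + n)) (Fin (n + n)) (w.1.adicCompletion E))).toBlocks₁₂).det

omit [Algebra.IsQuadraticExtension F E] in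
/-- `det_Δ q = detDeltaGL q_w`. [cite: Kudla1994, §3] -/
theorem detDelta_eq_detDeltaGL (w : PlacesOver E v) (q : UnitaryGroup.localPi E c (n + n) JD v) :
    detDelta F E c v n w q = detDeltaGL F E v n w ((q : UnitaryGroup.LocalGLPi E (n + n) v) w) := rfl

omit [NumberField F] [Algebra.IsQuadraticExtension F E] in
/-- `g ↦ det_Δ g` is continuous on `GL_{n+n}(E_w)`. [cite: MoeglinVignerasWaldspurger1987, Chap. 2 II.8] -/
theorem continuous_detDeltaGL (w : PlacesOver E v) : Continuous (detDeltaGL F E v n w) := by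
  refine Continuous.matrix_det (continuous_matrix fun i j => ?_)
  change Continuous fun g : GL (Fin (n + n)) (w.1.adicCompletion E) =>
    (g : Matrix (Fin (n + n)) (Fin (n + n)) (w.1.adicCompletion E)) (e₂ n (Sum.inl i)) (e₂ n (Sum.inl j)) +
      (g : Matrix (Fin (n + n)) (Fin (n + n)) (w.1.adicCompletion E)) (e₂ n (Sum.inl i)) (e₂ n (Sum.inr j))
  exact (Units.continuous_val.matrix_elem _ _).add (Units.continuous_val.matrix_elem _ _)

omit [NumberField F] [Algebra.IsQuadraticExtension F E] in
/-- `det_Δ 1 = 1`. [cite: Kudla1994, §3] -/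
theorem detDeltaGL_one (w : PlacesOver E v) : detDeltaGL F E v n w 1 = 1 := by
  rw [detDeltaGL, Units.val_one, Matrix.reindex_apply, Matrix.submatrix_one_equiv, ← Matrix.fromBlocks_one,
    Matrix.toBlocks_fromBlocks₁₁, Matrix.toBlocks_fromBlocks₁₂, add_zero, Matrix.det_one]

include hcδ hδ in
/-- **`χ_v(det_Δ q) = 1` once `q_w` is close to `1`**, for `χ_w` trivial near `1` (non-split `v`: one place above).
[cite: GelbartRogawski1991, §3.1 (3.1.2); MoeglinVignerasWaldspurger1987, Chap. 2 II.8] -/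
theorem chiDet_eq_one_nhds (w : PlacesOver E v) (hw : c • w.1 = w.1)
    (χv : ∀ w' : PlacesOver E v, (w'.1.adicCompletion E)ˣ →* ℂˣ)
    (hχ1 : ∀ᶠ x in 𝓝 (1 : w.1.adicCompletion E), ∀ hx : IsUnit x, χv w hx.unit = 1) :
    ∀ᶠ g in 𝓝 (1 : GL (Fin (n + n)) (w.1.adicCompletion E)), ∀ q : UnitaryGroup.localPi E c (n + n) JD v,
      (q : UnitaryGroup.LocalGLPi E (n + n) v) w = g → chiDet F E c v n χv q = 1 := by
  classical
  have ht : Tendsto (detDeltaGL F E v n w) (𝓝 1) (𝓝 1) := by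
    have := (continuous_detDeltaGL F E v n w).tendsto 1
    rwa [detDeltaGL_one] at this
  filter_upwards [ht.eventually hχ1] with g hg q hq
  rw [chiDet, PlacesOver.prod_eq_of_smul_eq c (galConj_ne_one_of_delta F E c hcδ hδ) w hw]
  by_cases hu : IsUnit (detDelta F E c v n w q)
  · rw [dif_pos hu]
    have hu' : IsUnit (detDeltaGL F E v n w g) := by rwa [detDelta_eq_detDeltaGL, hq] at hu
    have : hu.unit = hu'.unit := Units.ext (by simp [detDelta_eq_detDeltaGL, hq])
    rw [this]
    exact hg hu'
  · rw [dif_neg hu]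

/-! ## §3 Smoothness -/

include hcδ hδ hd hT₀ hJD in
/-- **SMOOTHNESS OF THE LOCAL WEIL REPRESENTATION OF `H(F_v)` AT A NON-SPLIT PLACE** (L6 of the GR-1 skeleton,
modulo the parabolic smoothness L6a of the section): with `β` splitting the multiplier of `r ∘ ι` and
`β|_{P_Δ} = χ_v ∘ det_Δ` (`χ_w` trivial near `1`), every `Φ` is fixed by `β(k)⁻¹ r(ι k)` for `k` in an open
subgroup of `H(F_v)`. [cite: MoeglinVignerasWaldspurger1987, Chap. 2 II.8; Kudla1994, Thm 3.1; GelbartRogawski1991, §3.1 Prop. 3.1.1] -/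
theorem smooth_of_parabolicSmooth (w : PlacesOver E v) (hw : c • w.1 = w.1)
    (χv : ∀ w' : PlacesOver E v, (w'.1.adicCompletion E)ˣ →* ℂˣ)
    (hχ1 : ∀ᶠ x in 𝓝 (1 : w.1.adicCompletion E), ∀ hx : IsUnit x, χv w hx.unit = 1)
    (hU : ImplementerUniqueUpToScalar (localSchrodinger F (n + n) (gramD F n T₀) v))
    (r : ImplementerSection (localSchrodinger F (n + n) (gramD F n T₀) v))
    (hL6a : ∀ Φ : SchwartzBruhat (Fin (n + n) → v.adicCompletion F),
      ∃ γ : ValuativeRel.ValueGroupWithZero (w.1.adicCompletion E), γ ≠ 0 ∧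
        ∀ p : UnitaryGroup.localPi E c (n + n) JD v, IsSiegelDelta F E c hcδ hδ hd v n hT₀ hJD p →
          ((p : UnitaryGroup.LocalGLPi E (n + n) v) w ∈ congruenceGL (n + n) γ) →
          r (iotaD F E c hcδ hδ hd v n hT₀ hJD p) Φ = Φ)
    (β : UnitaryGroup.localPi E c (n + n) JD v → ℂˣ)
    (hβ : ∀ g₁ g₂, β (g₁ * g₂) * r.cocycle hU (iotaD F E c hcδ hδ hd v n hT₀ hJD g₁) (iotaD F E c hcδ hδ hd v n hT₀ hJD g₂) =
      β g₁ * β g₂)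
    (hβP : ∀ p, IsSiegelDelta F E c hcδ hδ hd v n hT₀ hJD p → β p = chiDet F E c v n χv p)
    (Φ : SchwartzBruhat (Fin (n + n) → v.adicCompletion F)) :
    ∃ U : Subgroup (UnitaryGroup.localPi E c (n + n) JD v),
      IsOpen (U : Set (UnitaryGroup.localPi E c (n + n) JD v)) ∧
        ∀ k ∈ U, ((β k)⁻¹ : ℂˣ) • r (iotaD F E c hcδ hδ hd v n hT₀ hJD k) Φ = Φ := by
  classical
  set ι := iotaD F E c hcδ hδ hd v n hT₀ hJD with hι
  set wΔ := weylDelta F E c v n hJD (T₀ := T₀) with hwΔ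
  -- the target: the stabiliser of `Φ` under `ω = β⁻¹ · r ∘ ι`
  refine ⟨r.omegaStabilizer hU ι hβ Φ, r.isOpen_omegaStabilizer_of_mem_nhds hU ι hβ Φ ?_, fun k hk => hk⟩
  -- levels: L6a for `Φ` and for `Ψ = ω(w_Δ)⁻¹ Φ`, and `χ` near `1`
  obtain ⟨γΦ, hγΦ, hΦ⟩ := hL6a Φ
  obtain ⟨γΨ, hγΨ, hΨ⟩ := hL6a (r.omega ι β wΔ⁻¹ Φ)
  have hχ := chiDet_eq_one_nhds F E c hcδ hδ v n (JD := JD) w hw χv hχ1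
  -- the two targets in `GL_{n+n}(E_w)` and their transport through `R` and `R s`
  have hTP : ((congruenceGL (n + n) γΦ : Set (GL (Fin (n + n)) (w.1.adicCompletion E))) ∩
      {g | ∀ q : UnitaryGroup.localPi E c (n + n) JD v, (q : UnitaryGroup.LocalGLPi E (n + n) v) w = g →
        chiDet F E c v n χv q = 1}) ∈ 𝓝 1 :=
    inter_mem ((isOpen_congruenceGL hγΦ).mem_nhds (Subgroup.one_mem _)) hχ
  have hTN : ((congruenceGL (n + n) γΨ : Set (GL (Fin (n + n)) (w.1.adicCompletion E))) ∩
      {g | ∀ q : UnitaryGroup.localPi E c (n + n) JD v, (q : UnitaryGroup.LocalGLPi E (n + n) v) w = g →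
        chiDet F E c v n χv q = 1}) ∈ 𝓝 1 :=
    inter_mem ((isOpen_congruenceGL hγΨ).mem_nhds (Subgroup.one_mem _)) hχ
  obtain ⟨γ₁, hγ₁⟩ := exists_congruenceGL_conj_subset F E v w (toGLw F E v n w (cayGL F E v n)) hTP
  obtain ⟨γ₂, hγ₂⟩ := exists_congruenceGL_conj_subset F E v w (toGLw F E v n w (cayGL F E v n) * toGLw F E v n w (weylGL F E v n)) hTN
  obtain ⟨γ₃, hγ₃⟩ := exists_unit_lt_one F E v w
  set γ : ValuativeRel.ValueGroupWithZero (w.1.adicCompletion E) :=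
    min (γ₁ : ValuativeRel.ValueGroupWithZero (w.1.adicCompletion E)) (min γ₂ γ₃) with hγdef
  have hγ0 : γ ≠ 0 := ne_of_gt (lt_min (zero_lt_iff.2 γ₁.ne_zero) (lt_min (zero_lt_iff.2 γ₂.ne_zero) (zero_lt_iff.2 γ₃.ne_zero)))
  have hγlt : γ < 1 := lt_of_le_of_lt ((min_le_right _ _).trans (min_le_right _ _)) hγ₃
  have hγle₁ : congruenceGL (n + n) γ ≤ congruenceGL (n + n) (γ₁ : ValuativeRel.ValueGroupWithZero (w.1.adicCompletion E)) :=
    congruenceGL_mono (min_le_left _ _)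
  have hγle₂ : congruenceGL (n + n) γ ≤ congruenceGL (n + n) (γ₂ : ValuativeRel.ValueGroupWithZero (w.1.adicCompletion E)) :=
    congruenceGL_mono ((min_le_right _ _).trans (min_le_left _ _))
  -- the neighbourhood `{k : R⁻¹ k_w R ∈ K_γ}` and the factorisation
  refine r.omegaStabilizer_mem_nhds_of_factorisation hU ι hβ Φ (adComp_mem_congruenceGL_mem_nhds F E c v n w hγ0) wΔ
    fun k hk => ?_
  obtain ⟨p, u, hfac, hpΔ, huΔ, ⟨p', hp', hpw⟩, ⟨u', hu', huw⟩⟩ :=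
    exists_factorisation F E c hcδ hδ hd v n hT₀ hJD w hw hγlt k hk
  have hp1 := hγ₁ p' (hγle₁ hp')
  have hu1 := hγ₂ u' (hγle₂ hu')
  rw [← hpw] at hp1
  rw [← huw] at hu1
  refine ⟨p, u, hfac, ?_, ?_⟩
  · rw [ImplementerSection.omega_apply, hβP p hpΔ, hp1.2 p rfl, inv_one, one_smul]
    exact hΦ p hpΔ hp1.1
  · rw [ImplementerSection.omega_apply, hβP u huΔ, hu1.2 u rfl, inv_one, one_smul]
    exact hΨ u huΔ hu1.1

/-! ### Build-lane note (ops-buildfix G11b-3 recipe, LEDGER B13-1, 2026-08-21)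
`lean -o` (the hub build lane, never `lean`/the gate check) runs Lean 4.32's library-suggestion indexers
(`Lean.LibrarySuggestions.SymbolFrequency` / `SineQuaNon`, from their `exportEntriesFn`) over the statement of
every local theorem that is not a denied premise; on this family's statements (very large dependent binder
telescopes through the theta-kernel / dual-pair data) that fold runs for tens of minutes to hours and the build
lane kills the job (incident G11b-3, run/shared/lean/ops/buildfix/G11b-3-DOSSIER.md). `isDeniedPremise` skips
`[implicit_reducible]` constants before any fold, and a reducibility status on a *theorem* is inert (Meta never
unfolds `thmInfo`; the kernel ignores the attribute), so the public theorems of this file are tagged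
`[implicit_reducible]` purely to keep them out of that index. Only other effect: they are not offered by
`+suggestions` premise selectors. No statement or proof is changed; superseded if the operator lands a
deny-list form (`HarnessLib.PremiseIndex`). -/
set_option allowUnsafeReducibility true in
attribute [implicit_reducible]
  exists_congruenceGL_conj_subset exists_unit_lt_one detDelta_eq_detDeltaGL continuous_detDeltaGL
  detDeltaGL_one chiDet_eq_one_nhds smooth_of_parabolicSmooth

end Literature.NumberTheory.GelbartRogawski1991.UnitaryDualPair.LocalSplitting

end
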